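import Literature.NumberTheory.Automorphic.CDTTheorem712
import Literature.NumberTheory.EllipticCurves.HasseWeilAbelianConductorOggSaito
import Literature.NumberTheory.EllipticCurves.InertiaInvariantsMultiplicativeProofs
import HarnessLib

/-!
# Conrad–Diamond–Taylor Theorem 7.1.2 (and 7.2.4, Theorem A) on Ogg's formula at `p = 3` alone

Topic `NumberTheory/Automorphic`; a `…Proofs` companion (theorems only: no definitions, no named
facts, no instances) of `Literature.NumberTheory.Automorphic.CDTTheorem712`, landed by the tenured
seat of the named fact `Literature.NumberTheory.Automorphic.BCDT.CDT_theorem_7_1_2`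
(Conrad–Diamond–Taylor 1999, Thm. 7.1.2: "Let `E/ℚ` be an elliptic curve whose conductor is not
divisible by `27`. Then `E` is modular.") as a bottom-up step in the printed proof architecture of
that fact.

B. Conrad, F. Diamond, R. Taylor, *Modularity of certain potentially Barsotti–Tate Galois
representations*, J. Amer. Math. Soc. 12 (1999), 521–567 [ConradDiamondTaylor1999], p. 556, prove
Theorem 7.1.2 from Theorem 7.2.1, Lemma 7.2.3, Wiles' `3`–`5` switch and Theorem 7.2.2; the tree's
theorem `CDT_theorem_7_1_2_of_7_2_1_of_7_2_2_of_7_2_3_of_switch` (`CDTTheorem712`) is that printed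
proof, sentence by sentence, granted the four deep inputs as named facts and ONE Galois-side fact
for the sentence *"Since `ρ̄_{E',5} ≅ ρ̄_{E,5}`, the conductor of `E'` is not divisible by `27`"*:
Ogg's formula in its wild form at `ℓ = 5` for every elliptic curve over `ℚ`,
`∀ W, W.swanConductorAt_rationalTate_eq_wildConductorExponent 5` (`HasseWeilAbelianConductor`:
`Sw_𝔓(V₅ E) = δ_v(E)` at **every** place `v ∤ 5`).  That fact quantifies over all places, and at
the additive places of residue characteristic `2` it is Saito's theorem (Saito 1988, Thm. 1), which
no held source proves (Silverman, *ATAEC*, proof of IV.11.1, PDF p. 366: *"for this last case we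
refer the reader to Saito's proof"*); the tree isolates the two residue characteristics as the named
facts `…_of_ringChar_eq_two` (Saito) and `…_of_ringChar_eq_three` (Ogg 1967; PROVED in *ATAEC*,
PDF pp. 366–371) of `HasseWeilAbelianConductorOggSaito`, the good, multiplicative and `p ≥ 5`
cases being theorems (`HasseWeilAbelianConductorProofs`, `InertiaInvariantsMultiplicativeProofs`).

But the conductor step of Theorem 7.1.2 — and equally the hidden lemma of Theorem 7.2.4
(`27 ∣ N_E` ⇒ `ρ̄_{E,5}|_{ℚ(√5)}` absolutely irreducible) and the tame case of BCDT's Theorem 2.2.1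
(`E[5]` tame above `3` ⇒ `27 ∤ N_E`) — only ever evaluates Ogg's formula at the place `3` of `ℚ`,
where the residue characteristic is `3`.  This file therefore re-runs those three steps and every
assembly built on them on the strictly weaker input

* `∀ W : WeierstrassCurve ℚ, W.swanConductorAt_rationalTate_eq_wildConductorExponent_of_ringChar_eq_three 5`
  — Ogg's formula for the wild part at the additive places of residue characteristic `3`
  (Ogg 1967; Silverman *ATAEC* IV.11.1, case `p = 3`),

removing Saito's `p = 2` theorem from the trust base of CDT Thm. 7.1.2, of CDT Thm. 7.2.4, and of
the Modularity Theorem (BCDT Theorem A, `exists_isNewformOf`) and lang.S33 as assembled in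
`CDTTheorem712`:

* `WeierstrassCurve.swanConductorAt_rationalTate_eq_wildConductorExponent_of_ringChar_eq_three_at`
  — at a place `v ∤ ℓ` of residue characteristic `3` of any number field, `Sw_𝔓(V_ℓ E) = δ_v(E)`
  follows from the `p = 3` fact (additive case) and the theorems of the tree (good case:
  `swanConductorAt_rationalTate_eq_zero_of_hasGoodReductionAt`; multiplicative case:
  `swanConductorAt_rationalTate_eq_zero_of_hasMultiplicativeReductionAt_holds`, with
  `δ_v = f_v - ε_v = 1 - 1 = 0`) — the printed case split of the proof of IV.11.1 (PDF p. 366) at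
  one place;
* `WeierstrassCurve.wildConductorExponent_eq_of_isTorsionGaloisRep_of_ringChar_eq_three`,
  `WeierstrassCurve.twentySeven_dvd_conductorNorm_iff_of_isTorsionGaloisRep_of_ogg3`,
  `not_dvd_conductorNorm_of_isTorsionGaloisRep_five_of_ogg3` — the conductor step of p. 556 on the
  `p = 3` fact (the Swan invariance `swanConductorAt_rationalTate_eq_of_isTorsionGaloisRep` of
  `CDTSwanConductorProofs` is unconditional);
* `exists_mem_absUpperRamificationSubgroup_ne_one_of_dvd_conductorNorm_of_ogg3`,
  `not_dvd_conductorNorm_of_isTamelyRamifiedAbove_of_ogg3`,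
  `exists_orderOf_eq_three_of_dvd_conductorNorm_of_ogg3`,
  `not_dvd_conductorNorm_of_not_isAbsIrreducibleOverSqrt_of_ogg3` — `27 ∣ N_E` forces wild
  ramification of `E[5]` above `3` (the hidden lemma of 7.2.4, the tame case of BCDT 2.2.1);
* the assemblies `CDT_theorem_7_1_2_of_7_2_1_of_7_2_2_of_7_2_3_of_switch_of_ogg3`,
  `CDT_theorem_7_2_4_of_7_1_2_of_7_2_2_of_ogg3`,
  `CDT_theorem_7_2_4_of_7_2_1_of_7_2_2_of_7_2_3_of_switch_of_ogg3`,
  `exists_isNewformOf_of_theoremB_of_CDT721_722_723_switch_of_ogg3`,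
  `exists_isTorsionGaloisRep_and_isModular_of_isTamelyRamifiedAbove_of_ogg3`,
  `theoremB_of_wild_of_auxiliaryCurve_of_CDT721_of_ogg3`,
  `exists_isNewformOf_of_wild_of_auxiliaryCurve_of_CDT721_722_723_of_ogg3`, and the lang.S33 forms.

Trust base of `CDT_theorem_7_1_2` inside the tree after this file: {CDT Thm. 7.2.1, CDT Thm. 7.2.2,
CDT Lemma 7.2.3 (modularity conclusion), the `3`–`5` switch of p. 556 (or the Shepherd-Barron–Taylor
auxiliary curve of `BCDTTheoremB`), Ogg's formula at the additive places of residue characteristic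
`3` for `ℓ = 5`}; of the Modularity Theorem: the same with BCDT Thm. 2.2.1 (wild case) and the
auxiliary curve.  The four deep inputs are modularity lifting theorems (CDT Thm. 7.1.1 at `ℓ = 3, 5`,
Langlands–Tunnell, Diamond 1996) and Elkies' determination of rational points, none of which is in
Mathlib; they are the frontier of `CDT_theorem_7_1_2` recorded in the seat's notes.

## References

* [ConradDiamondTaylor1999] B. Conrad, F. Diamond, R. Taylor, J. Amer. Math. Soc. 12 (1999):
  Introduction (p. 522: `27 ∤ N_E` "if and only if `E` acquires semistable reduction over a tamely
  ramified extension of `ℚ₃`"), Thm. 7.1.2 (p. 551), Thm. 7.2.1 and the parenthesis "so the 'wild'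
  part of the conductor at `3` is trivial" (p. 553), Lemma 7.2.3 (p. 554), proof of Thm. 7.1.2 and
  Thm. 7.2.4 (p. 556).
* [BCDTJAMS2001] C. Breuil, B. Conrad, F. Diamond, R. Taylor, J. Amer. Math. Soc. 14 (2001):
  Thm. A, §2.2 (Thm. 2.2.1, case 1; Thm. 2.2.2).
* [SilvermanATAEC1994] J. H. Silverman, *Advanced Topics in the Arithmetic of Elliptic Curves*,
  §IV.10 (Definition, Thm. 10.2, PDF p. 358), §IV.11 (Ogg's formula 11.1, PDF p. 365; proof,
  pp. 366–371; the attribution of `p = 2` to Saito, p. 366).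
* [OggAJM1967] A. P. Ogg, *Elliptic curves and wild ramification*, Amer. J. Math. 89 (1967).
* [Saito1988] T. Saito, Duke Math. J. 57 (1988), Thm. 1 (the input this file removes).

## Design

Pure theorems; `noncomputable section`; one universe `u`; namespaces `WeierstrassCurve` (deliberate
dot-notation extensions next to `swanConductorAt_rationalTate_eq_wildConductorExponent_of_ringChar_eq_three`,
`wildConductorExponent_eq_of_isTorsionGaloisRep_of_swan`), `Literature.NumberTheory.Automorphic.BCDT`
(next to the theorems of `CDTTheorem712` they refine) and `Literature.NumberTheory.Automorphic`
(the lang.S33 corollaries); no instances, no `sorry`.  Axioms of every theorem: `propext`,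
`Classical.choice`, `Quot.sound`.
-/

noncomputable section

open scoped NumberField MatrixGroups
open Field IsDedekindDomain Matrix

universe u

/-! ## Ogg's formula at one place of residue characteristic `3`, from the `p = 3` fact -/

namespace WeierstrassCurve

open Literature.NumberTheory.EllipticCurves Literature.NumberTheory.GaloisRepresentations
  Literature.NumberTheory.DiophantineGeometry

section NumberField

variable {K : Type u} [Field K] [NumberField K]

omit [NumberField K] in
/-- The residue ring `𝓞 K ⧸ v` of a finite place `v ∋ p` has characteristic `p`. [folklore] -/
theorem ringChar_quot_asIdeal_eq_of_natCast_mem (v : HeightOneSpectrum (𝓞 K)) {p : ℕ}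
    (hp : p.Prime) (hv : (p : 𝓞 K) ∈ v.asIdeal) : ringChar (𝓞 K ⧸ v.asIdeal) = p := by
  haveI : Nontrivial (𝓞 K ⧸ v.asIdeal) := Ideal.Quotient.nontrivial_iff.mpr v.isPrime.ne_top
  apply CharP.ringChar_of_prime_eq_zero hp
  rw [← map_natCast (Ideal.Quotient.mk v.asIdeal) p, Ideal.Quotient.eq_zero_iff_mem]
  exact hv

variable (W : WeierstrassCurve K) (ℓ : ℕ) [Fact ℓ.Prime]

/-- **Ogg's formula in its wild form at a place of residue characteristic `3`, from its `p = 3`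
case.**  For an elliptic curve `E/K` over a number field, a prime `ℓ`, a finite place `v ∤ ℓ` of
residue characteristic `3` and a prime `𝔓 ∣ v` of `\bar ℤ_K`, `Sw_𝔓(V_ℓ E) = δ_v(E)` — granted
only the named fact `swanConductorAt_rationalTate_eq_wildConductorExponent_of_ringChar_eq_three W ℓ`
(`HasseWeilAbelianConductorOggSaito`: Ogg's formula at the *additive* places of residue
characteristic `3`; Ogg 1967, Silverman *ATAEC* IV.11.1 case `p = 3`, PDF pp. 366–371).  The
printed case split of the proof of IV.11.1 (PDF p. 366) at the one place `v`: at a place of good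
reduction both sides vanish (`swanConductorAt_rationalTate_eq_zero_of_hasGoodReductionAt`,
`wildConductorExponent_eq_zero_of_hasGoodReductionAt`, theorems of `HasseWeilAbelianConductorProofs`);
at a multiplicative place `Sw = 0` is the theorem
`swanConductorAt_rationalTate_eq_zero_of_hasMultiplicativeReductionAt_holds`
(`InertiaInvariantsMultiplicativeProofs`, *ATAEC* IV.10.2(b)) and `δ_v = f_v - ε_v = 1 - 1 = 0`
(`conductorExponent_eq_one_iff_holds`, `KodairaSymbol.tameConductorExponent_eq_one_iff`); at an
additive place it is the `p = 3` fact.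
[cite: SilvermanATAEC1994, IV.11.1 Ogg's formula, proof (PDF p. 366), case p = 3 (pp. 366–371)] -/
theorem swanConductorAt_rationalTate_eq_wildConductorExponent_of_ringChar_eq_three_at [W.IsElliptic]
    (h3 : W.swanConductorAt_rationalTate_eq_wildConductorExponent_of_ringChar_eq_three ℓ)
    (h : Continuous fun x : absoluteGaloisGroup K × RationalTateModule (geomPoints W) ℓ ↦
      rationalTateRepresentation (absoluteGaloisGroup K) (geomPoints W) ℓ x.1 x.2)
    {v : HeightOneSpectrum (𝓞 K)} (hℓ : (ℓ : 𝓞 K) ∉ v.asIdeal)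
    (hv3 : ringChar (𝓞 K ⧸ v.asIdeal) = 3)
    {𝔓 : Ideal (absIntegers (𝓞 K) K)} (h𝔓 : 𝔓 ∈ v.primesAbove) :
    (rationalTateGaloisRepOf (geomPoints W) ℓ h).swanConductorAt (𝓞 K) 𝔓 =
      (W.wildConductorExponent v : ℝ) := by
  rcases W.hasGoodReductionAt_or_hasMultiplicativeReductionAt_or_hasAdditiveReductionAt v with
    hv | hv | hv
  · rw [W.swanConductorAt_rationalTate_eq_zero_of_hasGoodReductionAt ℓ h hv hℓ h𝔓,
      W.wildConductorExponent_eq_zero_of_hasGoodReductionAt hv, Nat.cast_zero]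
  · have hf : W.conductorExponent v = 1 := (conductorExponent_eq_one_iff_holds v W).mpr hv
    have hng : ¬ (W.kodairaSymbolAt v).IsGood := fun hg ↦
      hv.not_hasGoodReductionAt ((isGood_kodairaSymbolAt_iff_holds v W).mp hg)
    have hna : ¬ (W.kodairaSymbolAt v).IsAdditive := fun ha' ↦
      hv.not_hasAdditiveReductionAt ((isAdditive_kodairaSymbolAt_iff_holds v W).mp ha')
    have hmul : (W.kodairaSymbolAt v).IsMultiplicative := by
      by_contra hc
      exact hna ⟨hng, hc⟩
    have hε : (W.kodairaSymbolAt v).tameConductorExponent = 1 :=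
      (KodairaSymbol.tameConductorExponent_eq_one_iff _).mpr hmul
    have hδ : W.wildConductorExponent v = 0 := by
      rw [wildConductorExponent, hf, hε]
    rw [W.swanConductorAt_rationalTate_eq_zero_of_hasMultiplicativeReductionAt_holds ℓ h v hℓ hv h𝔓,
      hδ, Nat.cast_zero]
  · exact h3 h v hℓ hv hv3 h𝔓

/-- **The wild conductor exponent at a place of residue characteristic `3` depends only on
`E[ℓ]`** — granted Ogg's formula at the additive places of residue characteristic `3` for both
curves (`…_of_ringChar_eq_three`, Ogg 1967): if `E[ℓ] ≅ E'[ℓ]` as `Γ_K`-modules (a common framed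
model `ρ̄`, `IsTorsionGaloisRep`) then `δ_v(E) = δ_v(E')` at every place `v ∤ ℓ` of residue
characteristic `3`.  As `wildConductorExponent_eq_of_isTorsionGaloisRep_of_swan`
(`CDTSwanConductorProofs`, there on Ogg's formula at all places), from the unconditional Swan
invariance `swanConductorAt_rationalTate_eq_of_isTorsionGaloisRep` and
`swanConductorAt_rationalTate_eq_wildConductorExponent_of_ringChar_eq_three_at`.
[cite: SilvermanATAEC1994, §IV.10 Definition of the conductor (PDF p. 358) and IV.11.1, case p = 3] -/
theorem wildConductorExponent_eq_of_isTorsionGaloisRep_of_ringChar_eq_three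
    (W W' : WeierstrassCurve K) [W.IsElliptic] [W'.IsElliptic] (ℓ : ℕ) [Fact ℓ.Prime]
    (h3 : W.swanConductorAt_rationalTate_eq_wildConductorExponent_of_ringChar_eq_three ℓ)
    (h3' : W'.swanConductorAt_rationalTate_eq_wildConductorExponent_of_ringChar_eq_three ℓ)
    {ρ : FramedGaloisRep K (ZMod ℓ) 2} (hρ : W.IsTorsionGaloisRep ℓ ρ)
    (hρ' : W'.IsTorsionGaloisRep ℓ ρ) (v : HeightOneSpectrum (𝓞 K))
    (hℓv : (ℓ : 𝓞 K) ∉ v.asIdeal) (hv3 : ringChar (𝓞 K ⧸ v.asIdeal) = 3) :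
    W.wildConductorExponent v = W'.wildConductorExponent v := by
  have h𝔓 := (HeightOneSpectrum.primesAbove_nonempty v).some_mem
  have h := W.continuous_rationalGaloisRepTate_holds ℓ
  have h' := W'.continuous_rationalGaloisRepTate_holds ℓ
  have e1 := W.swanConductorAt_rationalTate_eq_wildConductorExponent_of_ringChar_eq_three_at ℓ h3 h
    hℓv hv3 h𝔓
  have e2 := W'.swanConductorAt_rationalTate_eq_wildConductorExponent_of_ringChar_eq_three_at ℓ h3'
    h' hℓv hv3 h𝔓
  have := swanConductorAt_rationalTate_eq_of_isTorsionGaloisRep W W' ℓ h h' hρ hρ' hℓv h𝔓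
  rw [e1, e2] at this
  exact_mod_cast this

end NumberField

section Rat

open Rat.HeightOneSpectrum

/-- The place of `𝓞 ℚ` above `3` has residue characteristic `3`. [folklore] -/
theorem ringChar_quot_asIdeal_primesEquiv_symm_three :
    ringChar (𝓞 ℚ ⧸ ((primesEquiv (R := 𝓞 ℚ)).symm ⟨3, Nat.prime_three⟩).asIdeal) = 3 :=
  ringChar_quot_asIdeal_eq_of_natCast_mem _ Nat.prime_three
    ((natCast_mem_asIdeal_iff_eq_primesEquiv_symm _ Nat.prime_three).mpr rfl)

/-- **`27 ∣ N_E` depends only on `E[ℓ]` (`ℓ ≠ 3`)** — granted Ogg's formula at the additive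
places of residue characteristic `3` for both curves (`…_of_ringChar_eq_three`, Ogg 1967): for
elliptic curves `E, E'` over `ℚ` with a common framed model `ρ̄` of `E[ℓ]` and `E'[ℓ]`,
`27 ∣ N_E ↔ 27 ∣ N_{E'}`.  As `twentySeven_dvd_conductorNorm_iff_of_isTorsionGaloisRep`
(`CDTSwanConductorProofs`, there on Ogg's formula at all places): `27 ∣ N_E ↔ δ₃(E) ≠ 0`
(`twentySeven_dvd_conductorNorm_iff_wildConductorExponent_ne_zero`) and
`wildConductorExponent_eq_of_isTorsionGaloisRep_of_ringChar_eq_three` at the place above `3`.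
[folklore] -/
theorem twentySeven_dvd_conductorNorm_iff_of_isTorsionGaloisRep_of_ogg3 (W W' : WeierstrassCurve ℚ)
    [W.IsElliptic] [W'.IsElliptic] {ℓ : ℕ} [Fact ℓ.Prime] (hℓ3 : ℓ ≠ 3)
    (h3 : W.swanConductorAt_rationalTate_eq_wildConductorExponent_of_ringChar_eq_three ℓ)
    (h3' : W'.swanConductorAt_rationalTate_eq_wildConductorExponent_of_ringChar_eq_three ℓ)
    {ρ : FramedGaloisRep ℚ (ZMod ℓ) 2} (hρ : W.IsTorsionGaloisRep ℓ ρ)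
    (hρ' : W'.IsTorsionGaloisRep ℓ ρ) :
    27 ∣ W.conductorNorm ℤ ↔ 27 ∣ W'.conductorNorm ℤ := by
  set v : HeightOneSpectrum (𝓞 ℚ) := (primesEquiv (R := 𝓞 ℚ)).symm ⟨3, Nat.prime_three⟩ with hv
  have hℓv : ((ℓ : ℕ) : 𝓞 ℚ) ∉ v.asIdeal := by
    rw [natCast_mem_asIdeal_iff_eq_primesEquiv_symm v (Fact.out : ℓ.Prime), hv,
      (primesEquiv (R := 𝓞 ℚ)).symm.injective.eq_iff]
    intro h
    exact hℓ3 (congrArg Subtype.val h).symm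
  have hv3 : ringChar (𝓞 ℚ ⧸ v.asIdeal) = 3 := ringChar_quot_asIdeal_primesEquiv_symm_three
  rw [W.twentySeven_dvd_conductorNorm_iff_wildConductorExponent_ne_zero,
    W'.twentySeven_dvd_conductorNorm_iff_wildConductorExponent_ne_zero, ← hv,
    wildConductorExponent_eq_of_isTorsionGaloisRep_of_ringChar_eq_three W W' ℓ h3 h3' hρ hρ' v hℓv
      hv3]

end Rat

end WeierstrassCurve

namespace Literature.NumberTheory.Automorphic.BCDT

open WeierstrassCurve GaloisRepresentations

/-! ## The conductor step of Theorem 7.1.2 on Ogg's formula at `p = 3` -/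

/-- **Conrad–Diamond–Taylor 1999, proof of Theorem 7.1.2, the conductor step** (JAMS 12 (1999),
p. 556: *"Since `ρ̄_{E',5} ≅ ρ̄_{E,5}`, the conductor of `E'` is not divisible by `27`"*), PROVED
granted Ogg's formula at the additive places of residue characteristic `3` (`ℓ = 5`) for the two
curves (the named fact
`WeierstrassCurve.swanConductorAt_rationalTate_eq_wildConductorExponent_of_ringChar_eq_three · 5` of
`HasseWeilAbelianConductorOggSaito`; Ogg 1967, Silverman *ATAEC* IV.11.1 case `p = 3`).  Same
statement as `not_dvd_conductorNorm_of_isTorsionGaloisRep_five` (`CDTSwanConductorProofs`), whose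
input was Ogg's formula at all places `v ∤ 5` (including Saito's `p = 2`).
[cite: ConradDiamondTaylor1999, proof of Thm. 7.1.2 (p. 556)] -/
theorem not_dvd_conductorNorm_of_isTorsionGaloisRep_five_of_ogg3 (W W' : WeierstrassCurve ℚ)
    [W.IsElliptic] [W'.IsElliptic]
    (h3 : W.swanConductorAt_rationalTate_eq_wildConductorExponent_of_ringChar_eq_three 5)
    (h3' : W'.swanConductorAt_rationalTate_eq_wildConductorExponent_of_ringChar_eq_three 5)
    {ρ : ModPGaloisRep ℚ (ZMod 5) 2} (hρ : W.IsTorsionGaloisRep 5 ρ)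
    (hρ' : W'.IsTorsionGaloisRep 5 ρ) (h27 : ¬ 27 ∣ W.conductorNorm ℤ) :
    ¬ 27 ∣ W'.conductorNorm ℤ := by
  rwa [← twentySeven_dvd_conductorNorm_iff_of_isTorsionGaloisRep_of_ogg3 W W' (by norm_num) h3 h3'
    hρ hρ']

/-- The input of this file is implied by the input of `CDTTheorem712` (Ogg's formula in its wild
form at all places `v ∤ 5` specialises to its residue-characteristic-`3` additive part), so every
assembly below refines the corresponding one of `CDTTheorem712`. [folklore] -/
theorem ogg3_of_swan
    (hSw : ∀ W : WeierstrassCurve ℚ, W.swanConductorAt_rationalTate_eq_wildConductorExponent 5)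
    (W : WeierstrassCurve ℚ) :
    W.swanConductorAt_rationalTate_eq_wildConductorExponent_of_ringChar_eq_three 5 :=
  W.swanConductorAt_rationalTate_eq_wildConductorExponent_of_ringChar_eq_three_of_ringChar_eq 5
    (W.swanConductorAt_rationalTate_eq_wildConductorExponent_of_ringChar_eq_of_wild 5 (hSw W))

/-! ## Assembly: Theorem 7.1.2 from 7.2.1, 7.2.2, 7.2.3, the switch and Ogg's formula at `p = 3` -/

/-- **Conrad–Diamond–Taylor 1999, Theorem 7.1.2 from Theorem 7.2.1, Theorem 7.2.2, Lemma 7.2.3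
and the `3`–`5` switch, on Ogg's formula at `p = 3`** — the printed proof (JAMS 12 (1999), p. 556),
PROVED granted the four named facts `CDT_theorem_7_2_1` (`BCDTTheoremB`), `CDT_theorem_7_2_2`
(`BCDTModularity` Part 4), `CDT_lemma_7_2_3_isModular`, `CDT_three_five_switch` (`CDTTheorem712`)
and Ogg's formula for the wild part of the conductor at the additive places of residue
characteristic `3`, `ℓ = 5`, for every elliptic curve over `ℚ` (`hOgg3`, the named fact
`WeierstrassCurve.swanConductorAt_rationalTate_eq_wildConductorExponent_of_ringChar_eq_three · 5` of
`HasseWeilAbelianConductorOggSaito`; Ogg 1967, Silverman *ATAEC* IV.11.1, case `p = 3`, PDF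
pp. 366–371) — the input of the conductor step.  Word for word the proof of
`CDT_theorem_7_1_2_of_7_2_1_of_7_2_2_of_7_2_3_of_switch` (`CDTTheorem712`): by Thm. 7.2.1 we may
suppose that no framed model of `E[3]` is absolutely irreducible over `ℚ(√-3)`; fixing a framed
model `ρ̄` of `E[5]` (`exists_isTorsionGaloisRep`), by Lemma 7.2.3 we may assume `ρ̄|_{ℚ(√5)}`
absolutely irreducible; the switch gives `E'` with `E'[5] ≅ E[5]` (the same `ρ̄`) and
`ρ̄_{E',3}|_{ℚ(√-3)}` absolutely irreducible; `27 ∤ N_{E'}`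
(`not_dvd_conductorNorm_of_isTorsionGaloisRep_five_of_ogg3`); `E'` is modular by Thm. 7.2.1, so `ρ̄`
is modular (`IsModular.isModular_of_isTorsionGaloisRep''`), and `E` is modular by Thm. 7.2.2.
[cite: ConradDiamondTaylor1999, Thm. 7.1.2 (proof, p. 556)] -/
theorem CDT_theorem_7_1_2_of_7_2_1_of_7_2_2_of_7_2_3_of_switch_of_ogg3 (h721 : CDT_theorem_7_2_1)
    (h722 : CDT_theorem_7_2_2) (h723 : CDT_lemma_7_2_3_isModular) (hsw : CDT_three_five_switch)
    (hOgg3 : ∀ W : WeierstrassCurve ℚ,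
      W.swanConductorAt_rationalTate_eq_wildConductorExponent_of_ringChar_eq_three 5) :
    CDT_theorem_7_1_2 := by
  intro W _ _ h27
  -- "According to Theorem 7.2.1, we may suppose that `ρ̄_{E,3}|_{ℚ(√-3)}` is not abs. irreducible"
  by_cases h3 : ∃ ρ₃ : ModPGaloisRep ℚ (ZMod 3) 2,
      W.IsTorsionGaloisRep 3 ρ₃ ∧ ρ₃.IsAbsIrreducibleOverSqrt (-3)
  · obtain ⟨ρ₃, hρ₃, h3i⟩ := h3
    exact h721 W ρ₃ hρ₃ h3i h27
  push Not at h3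
  -- "By Lemma 7.2.3, we may assume `ρ̄_{E,5}|_{ℚ(√5)}` is absolutely irreducible"
  obtain ⟨ρ, hρ⟩ := W.exists_isTorsionGaloisRep 5
  by_cases h5 : ρ.IsAbsIrreducibleOverSqrt 5
  swap
  · obtain ⟨ρ₃, hρ₃⟩ := W.exists_isTorsionGaloisRep 3
    exact h723 W ρ hρ h5 ρ₃ hρ₃ (h3 ρ₃ hρ₃)
  -- the `3`–`5` switch
  obtain ⟨W', hW', hρ', ρ₃', hρ₃', h3'⟩ := hsw W h27 h3 ρ hρ h5
  haveI := hW'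
  haveI : NeZero (W'.conductorNorm ℤ) := ⟨(conductorNorm_pos_holds W').ne'⟩
  -- "Since `ρ̄_{E',5} ≅ ρ̄_{E,5}`, the conductor of `E'` is not divisible by `27`"
  have h27' : ¬ 27 ∣ W'.conductorNorm ℤ :=
    not_dvd_conductorNorm_of_isTorsionGaloisRep_five_of_ogg3 W W' (hOgg3 W) (hOgg3 W') hρ hρ' h27
  -- "Therefore `E'` is modular by Theorem 7.2.1, so `ρ̄_{E,5} ≅ ρ̄_{E',5}` is modular"
  have hE' : IsModular W' := h721 W' ρ₃' hρ₃' h3' h27'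
  have hρmod : ρ.IsModular := hE'.isModular_of_isTorsionGaloisRep'' hρ'
  -- "Therefore `E` is modular by Theorem 7.2.2"
  exact h722 W ρ hρ h5 hρmod

/-! ## `27 ∣ N_E` forces wild ramification of `E[5]` above `3` — on Ogg's formula at `p = 3` -/

open EllipticCurves in
/-- **`27 ∣ N_E` ⇒ `E[5]` is wildly ramified above `3`, from Ogg's formula at `p = 3`.**  For an
elliptic curve `E / ℚ` with `27 ∣ N_E` and any framed model `ρ̄` of `E[5]`, some element `σ` of
some wild ramification group `Γ_ℚ^u(𝔓)` (`u > 0`, `𝔓` a prime of `ℚ̄` above the place `v ∋ 3`) has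
`ρ̄(σ) ≠ 1` — granted `Sw_𝔓(V₅ E) = δ_v(E)` at the additive places of residue characteristic `3`
(`h3`, the named fact `…_of_ringChar_eq_three W 5`).  Same statement and proof as
`exists_mem_absUpperRamificationSubgroup_ne_one_of_dvd_conductorNorm_of_swan` (`CDTTheorem712`,
there on Ogg's formula at all places): `27 ∣ N_E` gives `δ₃(E) ≠ 0`
(`twentySeven_dvd_conductorNorm_iff_wildConductorExponent_ne_zero`), hence `Sw_𝔓(V₅ E) ≠ 0`
(`swanConductorAt_rationalTate_eq_wildConductorExponent_of_ringChar_eq_three_at`, the place above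
`3` having residue characteristic `3`), so `V₅ E` is not tame at `𝔓`
(`IsTameAt.swanConductorAt_eq_zero`): some `σ ∈ Γ_ℚ^u(𝔓)`, `u > 0`, acts non-trivially on `V₅ E`,
hence moves a point of some `E[5ⁿ]`; its action there has `3`-power order, so by coprimality it
already moves a point of `E[5]`.  CDT, Introduction, p. 522: `27 ∤ N_E` "if and only if `E`
acquires semistable reduction over a tamely ramified extension of `ℚ₃`", in the direction used on
pp. 553, 556. [cite: ConradDiamondTaylor1999, Introduction (p. 522) and proof of Thm. 7.1.2 (p. 556)] -/
theorem exists_mem_absUpperRamificationSubgroup_ne_one_of_dvd_conductorNorm_of_ogg3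
    (W : WeierstrassCurve ℚ) [W.IsElliptic]
    (h3 : W.swanConductorAt_rationalTate_eq_wildConductorExponent_of_ringChar_eq_three 5)
    {ρ : ModPGaloisRep ℚ (ZMod 5) 2} (hρ : W.IsTorsionGaloisRep 5 ρ)
    (h27 : 27 ∣ W.conductorNorm ℤ) :
    ∃ v : HeightOneSpectrum (𝓞 ℚ), ((3 : ℕ) : 𝓞 ℚ) ∈ v.asIdeal ∧ ∃ 𝔓 ∈ v.primesAbove,
      ∃ u : ℝ, 0 < u ∧ ∃ σ ∈ absUpperRamificationSubgroup (𝓞 ℚ) 𝔓 u, ρ σ ≠ 1 := by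
  classical
  -- the place of `𝓞 ℚ` above `3` and a prime `𝔓` of `\bar ℤ` above it
  set v : HeightOneSpectrum (𝓞 ℚ) :=
    (Rat.HeightOneSpectrum.primesEquiv (R := 𝓞 ℚ)).symm ⟨3, Nat.prime_three⟩ with hv
  set 𝔓 := (HeightOneSpectrum.primesAbove_nonempty v).some with h𝔓def
  have h𝔓 : 𝔓 ∈ v.primesAbove := (HeightOneSpectrum.primesAbove_nonempty v).some_mem
  have h3v : ((3 : ℕ) : 𝓞 ℚ) ∈ v.asIdeal := by
    rw [natCast_mem_asIdeal_iff_eq_primesEquiv_symm v Nat.prime_three]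
  have h5 : ((5 : ℕ) : 𝓞 ℚ) ∉ v.asIdeal := by
    rw [natCast_mem_asIdeal_iff_eq_primesEquiv_symm v Nat.prime_five, hv,
      (Rat.HeightOneSpectrum.primesEquiv (R := 𝓞 ℚ)).symm.injective.eq_iff]
    intro h
    have := congrArg Subtype.val h
    norm_num at this
  have hv3 : ringChar (𝓞 ℚ ⧸ v.asIdeal) = 3 := ringChar_quot_asIdeal_primesEquiv_symm_three
  -- `δ₃(E) ≠ 0`, so `Sw_𝔓(V₅ E) ≠ 0`: `V₅ E` is not tame at `𝔓`
  have hδ : W.wildConductorExponent v ≠ 0 :=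
    (W.twentySeven_dvd_conductorNorm_iff_wildConductorExponent_ne_zero).mp h27
  have hcont : Continuous fun x : absoluteGaloisGroup ℚ × RationalTateModule (geomPoints W) 5 ↦
      rationalTateRepresentation (absoluteGaloisGroup ℚ) (geomPoints W) 5 x.1 x.2 :=
    W.continuous_rationalGaloisRepTate_holds 5
  set ρV := rationalTateGaloisRepOf (geomPoints W) 5 hcont with hρV
  have hsw : ρV.swanConductorAt (𝓞 ℚ) 𝔓 ≠ 0 := by
    rw [hρV, W.swanConductorAt_rationalTate_eq_wildConductorExponent_of_ringChar_eq_three_at 5 h3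
      hcont h5 hv3 h𝔓]
    exact_mod_cast hδ
  obtain ⟨u, hu, σ, hσu, hσV⟩ : ∃ u : ℝ, 0 < u ∧
      ∃ σ ∈ absUpperRamificationSubgroup (𝓞 ℚ) 𝔓 u, ρV σ ≠ 1 := by
    by_contra hall
    push Not at hall
    exact hsw (GaloisRep.IsTameAt.swanConductorAt_eq_zero fun u hu σ hσ ↦ hall u hu σ hσ)
  -- it moves a point of `E[5ⁿ]`
  obtain ⟨n, x, hn⟩ := exists_smul_proj_ne_of_ne_one W 5 hσV
  set P : geomPoints W := TateModule.proj 5 n x with hPdef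
  have hP : 5 ^ n • P = 0 :=
    AddSubgroup.torsionBy.nsmul_iff.mp (proj_tateModule_mem_geomTorsion W 5 n x)
  -- the action of `σ` on `E[5ⁿ]` has `3`-power order
  obtain ⟨k, hk⟩ := W.exists_pow_smul_geomTorsion_eq_of_mem_absUpperRamificationSubgroup h𝔓 h3v
    hu 5 n ⟨σ, hσu⟩
  have hN : ∀ a : geomPoints W, 5 ^ n • a = 0 → σ ^ 3 ^ k • a = a := fun a ha ↦
    hk a (AddSubgroup.torsionBy.nsmul_iff.mpr ha)
  -- hence `σ` already moves a point of `E[5]`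
  obtain ⟨P₁, hP₁5, hσP₁⟩ : ∃ P₁ : geomPoints W, 5 • P₁ = 0 ∧ σ • P₁ ≠ P₁ := by
    by_contra hall
    simp only [not_exists, not_and, not_not] at hall
    have hcop : (3 ^ k).Coprime 5 := Nat.Coprime.pow_left k (by norm_num)
    exact hn (smul_eq_self_of_pow_smul_eq_self_of_coprime hcop hall hN P hP)
  -- so `ρ̄(σ) ≠ 1`
  refine ⟨v, h3v, 𝔓, h𝔓, u, hu, σ, hσu, fun h1 ↦ hσP₁ ?_⟩
  obtain ⟨e, he⟩ := hρ
  have h2 := he σ ⟨P₁, AddSubgroup.torsionBy.nsmul_iff.mpr hP₁5⟩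
  rw [h1, Units.val_one, one_mulVec] at h2
  exact congrArg Subtype.val (e.injective h2)

/-- **`ρ̄_{E,5}` tamely ramified above `3` ⇒ `27 ∤ N_E`, on Ogg's formula at `p = 3`** (`h3`): as
`not_dvd_conductorNorm_of_isTamelyRamifiedAbove_of_swan` (`CDTTheorem712`), the contrapositive of
`exists_mem_absUpperRamificationSubgroup_ne_one_of_dvd_conductorNorm_of_ogg3`.  This is the step
"`E` acquires semistable reduction over a tame extension of `ℚ₃`, so `27 ∤ N_E`" of BCDT §2.2,
case 1 (CDT 1999, Introduction, p. 522). [cite: ConradDiamondTaylor1999, Introduction (p. 522)] -/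
theorem not_dvd_conductorNorm_of_isTamelyRamifiedAbove_of_ogg3 (W : WeierstrassCurve ℚ)
    [W.IsElliptic] (h3 : W.swanConductorAt_rationalTate_eq_wildConductorExponent_of_ringChar_eq_three 5)
    {ρ : ModPGaloisRep ℚ (ZMod 5) 2} (hρ : W.IsTorsionGaloisRep 5 ρ)
    (htame : ρ.IsTamelyRamifiedAbove 3) : ¬ 27 ∣ W.conductorNorm ℤ := by
  intro h27
  obtain ⟨v, hv, 𝔓, h𝔓, u, hu, σ, hσ, hne⟩ :=
    exists_mem_absUpperRamificationSubgroup_ne_one_of_dvd_conductorNorm_of_ogg3 W h3 hρ h27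
  exact hne (htame v hv 𝔓 h𝔓 u hu σ hσ)

/-- **The hidden lemma of CDT Thm. 7.2.4, arithmetic half, on Ogg's formula at `p = 3`.**  For an
elliptic curve `E / ℚ` with `27 ∣ N_E`, the image of `ρ̄_{E,5}` contains an element of order `3` —
granted `Sw_𝔓(V₅ E) = δ_v(E)` at the additive places of residue characteristic `3` (`h3`).  As
`exists_orderOf_eq_three_of_dvd_conductorNorm_of_swan` (`CDTTheorem712`): the wild element
`σ ∈ Γ_ℚ^u(𝔓)` with `ρ̄(σ) ≠ 1` acts on `E[5]` with `3`-power order, so a power of `ρ̄(σ)` has order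
`3`. [cite: ConradDiamondTaylor1999, §7.2, proof of Thm. 7.1.2 (p. 556) and Introduction (p. 522)] -/
theorem exists_orderOf_eq_three_of_dvd_conductorNorm_of_ogg3 (W : WeierstrassCurve ℚ)
    [W.IsElliptic] (h3 : W.swanConductorAt_rationalTate_eq_wildConductorExponent_of_ringChar_eq_three 5)
    {ρ : ModPGaloisRep ℚ (ZMod 5) 2} (hρ : W.IsTorsionGaloisRep 5 ρ)
    (h27 : 27 ∣ W.conductorNorm ℤ) : ∃ σ : absoluteGaloisGroup ℚ, orderOf (ρ σ) = 3 := by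
  obtain ⟨v, hv, 𝔓, h𝔓, u, hu, σ, hσ, hne⟩ :=
    exists_mem_absUpperRamificationSubgroup_ne_one_of_dvd_conductorNorm_of_ogg3 W h3 hρ h27
  -- the action of `σ` on `E[5]` has `3`-power order
  obtain ⟨k, hk⟩ := W.exists_pow_smul_geomTorsion_eq_of_mem_absUpperRamificationSubgroup h𝔓 hv
    hu 5 1 ⟨σ, hσ⟩
  have hk' : ∀ P ∈ geomTorsion W ((5 : ℕ) : ℤ), σ ^ 3 ^ k • P = P := fun P hP ↦
    hk P (by rw [pow_one]; exact hP)
  have hρN : (ρ σ) ^ 3 ^ k = 1 := by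
    rw [← map_pow]
    exact eq_one_of_forall_smul_eq hρ fun Q ↦ Subtype.ext (hk' Q Q.2)
  obtain ⟨m, hm⟩ := exists_orderOf_pow_eq_of_pow_prime_pow_eq_one Nat.prime_three hρN hne
  exact ⟨σ ^ m, by rw [map_pow]; exact hm⟩

/-- **The hidden lemma of CDT Thm. 7.2.4 on Ogg's formula at `p = 3`**: for an elliptic curve
`E / ℚ`, if `ρ̄_{E,5}|_{ℚ(√5)}` is not absolutely irreducible then `27 ∤ N_E` — granted
`Sw_𝔓(V₅ E) = δ_v(E)` at the additive places of residue characteristic `3` (`h3`).  As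
`not_dvd_conductorNorm_of_not_isAbsIrreducibleOverSqrt_of_swan` (`CDTTheorem712`), combining
`exists_orderOf_eq_three_of_dvd_conductorNorm_of_ogg3` with the group-theoretic half
`isAbsIrreducibleOverSqrt_five_of_orderOf_eq_three` (`CDTModularityProofs`) and `det ρ̄_{E,5} = χ̄₅`
(`det_eq_modPCyclotomicCharacter_of_isTorsionGaloisRep_holds`, the Weil pairing).
[cite: ConradDiamondTaylor1999, Thm. 7.2.4 (p. 556) with proof of Lemma 7.2.3 (p. 554)] -/
theorem not_dvd_conductorNorm_of_not_isAbsIrreducibleOverSqrt_of_ogg3 (W : WeierstrassCurve ℚ)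
    [W.IsElliptic] (h3 : W.swanConductorAt_rationalTate_eq_wildConductorExponent_of_ringChar_eq_three 5)
    {ρ : ModPGaloisRep ℚ (ZMod 5) 2} (hρ : W.IsTorsionGaloisRep 5 ρ)
    (h : ¬ ρ.IsAbsIrreducibleOverSqrt 5) : ¬ 27 ∣ W.conductorNorm ℤ := by
  intro h27
  obtain ⟨σ, hσ⟩ := exists_orderOf_eq_three_of_dvd_conductorNorm_of_ogg3 W h3 hρ h27
  exact h (isAbsIrreducibleOverSqrt_five_of_orderOf_eq_three ρ
    (W.det_eq_modPCyclotomicCharacter_of_isTorsionGaloisRep_holds 5 ρ hρ) hσ)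

/-! ## Theorem 7.2.4, Theorem A and Theorem B on Ogg's formula at `p = 3` -/

/-- **Conrad–Diamond–Taylor 1999, Theorem 7.2.4 from Theorems 7.1.2 and 7.2.2, on Ogg's formula
at `p = 3`** (JAMS 12 (1999), p. 556: "the following strengthening of Theorem 7.2.2, immediate from
Theorem 7.1.2"): as `CDT_theorem_7_2_4_of_7_1_2_of_7_2_2_of_swan` (`CDTTheorem712`), with the hidden
lemma taken from `not_dvd_conductorNorm_of_not_isAbsIrreducibleOverSqrt_of_ogg3`, so that the
Galois-side input is Ogg's formula at the additive places of residue characteristic `3` only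
(`hOgg3`). [cite: ConradDiamondTaylor1999, Thm. 7.2.4] -/
theorem CDT_theorem_7_2_4_of_7_1_2_of_7_2_2_of_ogg3 (h712 : CDT_theorem_7_1_2)
    (h722 : CDT_theorem_7_2_2)
    (hOgg3 : ∀ W : WeierstrassCurve ℚ,
      W.swanConductorAt_rationalTate_eq_wildConductorExponent_of_ringChar_eq_three 5) :
    CDT_theorem_7_2_4 := by
  intro W _ _ ρ hρ hyp
  by_cases habs : ρ.IsAbsIrreducibleOverSqrt 5
  · exact h722 W ρ hρ habs (hyp.resolve_right (not_not_intro habs))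
  · exact h712 W (not_dvd_conductorNorm_of_not_isAbsIrreducibleOverSqrt_of_ogg3 W (hOgg3 W) hρ habs)

/-- **Conrad–Diamond–Taylor 1999, Theorem 7.2.4 from Theorems 7.2.1, 7.2.2, Lemma 7.2.3 and the
`3`–`5` switch, on Ogg's formula at `p = 3`** (JAMS 12 (1999), p. 556): the named fact
`CDT_theorem_7_2_4` of `BCDTModularity`, PROVED granted those four named facts and Ogg's formula
at the additive places of residue characteristic `3`, `ℓ = 5`, for every elliptic curve over `ℚ`
(`hOgg3`), which serves both the conductor step of 7.1.2 and the hidden lemma of 7.2.4: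
`CDT_theorem_7_2_4_of_7_1_2_of_7_2_2_of_ogg3` applied to
`CDT_theorem_7_1_2_of_7_2_1_of_7_2_2_of_7_2_3_of_switch_of_ogg3`.  Trust base of `CDT_theorem_7_2_4`
inside the tree after this file: {CDT Thm. 7.2.1, Thm. 7.2.2, Lemma 7.2.3 (modularity), the `3`–`5`
switch (p. 556), Ogg's formula at `p = 3` for `ℓ = 5`}. [cite: ConradDiamondTaylor1999, Thm. 7.2.4] -/
theorem CDT_theorem_7_2_4_of_7_2_1_of_7_2_2_of_7_2_3_of_switch_of_ogg3 (h721 : CDT_theorem_7_2_1)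
    (h722 : CDT_theorem_7_2_2) (h723 : CDT_lemma_7_2_3_isModular) (hsw : CDT_three_five_switch)
    (hOgg3 : ∀ W : WeierstrassCurve ℚ,
      W.swanConductorAt_rationalTate_eq_wildConductorExponent_of_ringChar_eq_three 5) :
    CDT_theorem_7_2_4 :=
  CDT_theorem_7_2_4_of_7_1_2_of_7_2_2_of_ogg3
    (CDT_theorem_7_1_2_of_7_2_1_of_7_2_2_of_7_2_3_of_switch_of_ogg3 h721 h722 h723 hsw hOgg3) h722
    hOgg3

/-- **BCDT Theorem A** (`Literature.NumberTheory.EllipticCurves.ModularForms.exists_isNewformOf`, the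
Modularity Theorem in the tree's form) **from Theorem B and the printed inputs of CDT §7.2, on Ogg's
formula at `p = 3`**: `exists_isNewformOf_of_theoremB_of_CDT` (`BCDTModularity` Part 3) with
`CDT_theorem_7_2_4` discharged by `CDT_theorem_7_2_4_of_7_2_1_of_7_2_2_of_7_2_3_of_switch_of_ogg3`.
Trust base of the Modularity Theorem in the tree after this file: {BCDT Thm. B; CDT Thm. 7.2.1,
Thm. 7.2.2, Lemma 7.2.3 (modularity), the `3`–`5` switch; Ogg's formula at `p = 3` for `ℓ = 5`}.
[cite: BCDTJAMS2001, Theorem A] -/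
theorem exists_isNewformOf_of_theoremB_of_CDT721_722_723_switch_of_ogg3 (hB : theoremB)
    (h721 : CDT_theorem_7_2_1) (h722 : CDT_theorem_7_2_2) (h723 : CDT_lemma_7_2_3_isModular)
    (hsw : CDT_three_five_switch)
    (hOgg3 : ∀ W : WeierstrassCurve ℚ,
      W.swanConductorAt_rationalTate_eq_wildConductorExponent_of_ringChar_eq_three 5) :
    EllipticCurves.ModularForms.exists_isNewformOf :=
  exists_isNewformOf_of_theoremB_of_CDT hB
    (CDT_theorem_7_2_4_of_7_2_1_of_7_2_2_of_7_2_3_of_switch_of_ogg3 h721 h722 h723 hsw hOgg3)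

/-- **BCDT Theorem 2.2.1, the tame case, on Ogg's formula at `p = 3`** (§2.2, proof of
Thm. 2.2.1, case 1: "`ρ̄` is tamely ramified at `3` … In the first case, `E` is modular by Theorem
7.2.1 of [CDT]"): as `exists_isTorsionGaloisRep_and_isModular_of_isTamelyRamifiedAbove_of_swan`
(`CDTTheorem712`), with `27 ∤ N_E` taken from `not_dvd_conductorNorm_of_isTamelyRamifiedAbove_of_ogg3`.
[cite: BCDTJAMS2001, §2.2 (proof of Thm. 2.2.1, case 1)] -/
theorem exists_isTorsionGaloisRep_and_isModular_of_isTamelyRamifiedAbove_of_ogg3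
    (hE : exists_isTorsionGaloisRep_five_and_surjective_three) (h721 : CDT_theorem_7_2_1)
    (hOgg3 : ∀ W : WeierstrassCurve ℚ,
      W.swanConductorAt_rationalTate_eq_wildConductorExponent_of_ringChar_eq_three 5)
    (ρ : ModPGaloisRep ℚ (ZMod 5) 2) (hirr : FramedRep.IsAbsolutelyIrreducible ρ)
    (hdet : ∀ σ : absoluteGaloisGroup ℚ,
      Matrix.GeneralLinearGroup.det (ρ σ) = modPCyclotomicCharacterZMod ℚ 5 σ)
    (htame : ρ.IsTamelyRamifiedAbove 3) :
    ∃ (W : WeierstrassCurve ℚ) (_ : W.IsElliptic) (_ : NeZero (W.conductorNorm ℤ)),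
      W.IsTorsionGaloisRep 5 ρ ∧ IsModular W := by
  obtain ⟨W, hW, hρ, ρ₃, hρ₃, hsurj⟩ := hE ρ hirr hdet
  haveI : NeZero (W.conductorNorm ℤ) := ⟨(conductorNorm_pos_holds W).ne'⟩
  exact ⟨W, hW, inferInstance, hρ,
    h721 W ρ₃ hρ₃ (isAbsIrreducibleOverSqrt_neg_three_of_surjective ρ₃ hsurj)
      (not_dvd_conductorNorm_of_isTamelyRamifiedAbove_of_ogg3 W (hOgg3 W) hρ htame)⟩

/-- **BCDT Theorem B = Theorem 2.2.1 from its printed inputs, on Ogg's formula at `p = 3`**: as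
`theoremB_of_wild_of_auxiliaryCurve_of_CDT721_of_swan` (`CDTTheorem712`: wild case + auxiliary
curve + CDT Thm. 7.2.1; case distinction tame/wild above `3`; "`E` modular ⇒ `ρ̄_{E,5}` modular"
proved), with the tame case run on Ogg's formula at `p = 3` (`hOgg3`).
[cite: BCDTJAMS2001, Theorem 2.2.1] -/
theorem theoremB_of_wild_of_auxiliaryCurve_of_CDT721_of_ogg3
    (hW : exists_isTorsionGaloisRep_and_isModular_of_not_isTamelyRamifiedAbove)
    (hE : exists_isTorsionGaloisRep_five_and_surjective_three) (h721 : CDT_theorem_7_2_1)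
    (hOgg3 : ∀ W : WeierstrassCurve ℚ,
      W.swanConductorAt_rationalTate_eq_wildConductorExponent_of_ringChar_eq_three 5) :
    theoremB := by
  refine theoremB_of_exists_isTorsionGaloisRep_and_isModular fun ρ hirr hdet ↦ ?_
  by_cases htame : ρ.IsTamelyRamifiedAbove 3
  · exact exists_isTorsionGaloisRep_and_isModular_of_isTamelyRamifiedAbove_of_ogg3 hE h721 hOgg3 ρ
      hirr hdet htame
  · exact hW ρ hirr hdet htame

/-- **The Modularity Theorem (BCDT Theorem A, `exists_isNewformOf`) from the deep printed inputs
and Ogg's formula at `p = 3`.**  Granted (i) the wild case of BCDT Thm. 2.2.1, (ii) the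
Shepherd-Barron–Taylor auxiliary curve (the `3`–`5` switch of both papers), (iii) CDT Thm. 7.2.1,
(iv) CDT Thm. 7.2.2, (v) the modularity conclusion of CDT Lemma 7.2.3 (Elkies), and (vi) Ogg's
formula for the wild part of the conductor at the additive places of residue characteristic `3`,
`ℓ = 5`, for every elliptic curve over `ℚ` (Ogg 1967; proved in Silverman *ATAEC*, pp. 366–371),
every elliptic curve over `ℚ` is modular: as
`exists_isNewformOf_of_wild_of_auxiliaryCurve_of_CDT721_722_723_of_swan` (`CDTTheorem712`), with
Saito's theorem (Ogg's formula in residue characteristic `2`) no longer an input.  This is the trust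
base of the Modularity Theorem inside the tree after this file. [cite: BCDTJAMS2001, Theorem A] -/
theorem exists_isNewformOf_of_wild_of_auxiliaryCurve_of_CDT721_722_723_of_ogg3
    (hW : exists_isTorsionGaloisRep_and_isModular_of_not_isTamelyRamifiedAbove)
    (hE : exists_isTorsionGaloisRep_five_and_surjective_three) (h721 : CDT_theorem_7_2_1)
    (h722 : CDT_theorem_7_2_2) (h723 : CDT_lemma_7_2_3_isModular)
    (hOgg3 : ∀ W : WeierstrassCurve ℚ,
      W.swanConductorAt_rationalTate_eq_wildConductorExponent_of_ringChar_eq_three 5) :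
    EllipticCurves.ModularForms.exists_isNewformOf :=
  exists_isNewformOf_of_theoremB_of_CDT721_722_723_switch_of_ogg3
    (theoremB_of_wild_of_auxiliaryCurve_of_CDT721_of_ogg3 hW hE h721 hOgg3) h721 h722 h723
    (CDT_three_five_switch_of_exists_isTorsionGaloisRep_five_and_surjective_three hE) hOgg3

end Literature.NumberTheory.Automorphic.BCDT

namespace Literature.NumberTheory.Automorphic

/-- **lang.S33 from the deep printed inputs and Ogg's formula at `p = 3`**: granted the six named
facts of `BCDT.exists_isNewformOf_of_wild_of_auxiliaryCurve_of_CDT721_722_723_of_ogg3`, every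
elliptic `E / ℚ` has a cusp form `f ∈ S₂(Γ₀(N))` with `a_p(f) = p + 1 - #E(𝔽_p)` for `p ∤ N Δ_E`
(`exists_cuspForm_coeff_eq_frobeniusTrace_of_exists_isNewformOf`, `LangWave0Proofs`).
[cite: BCDTJAMS2001, Theorem 2.2.2] -/
theorem exists_cuspForm_coeff_eq_frobeniusTrace_of_wild_of_auxiliaryCurve_of_CDT721_722_723_of_ogg3
    (hW : BCDT.exists_isTorsionGaloisRep_and_isModular_of_not_isTamelyRamifiedAbove)
    (hE : BCDT.exists_isTorsionGaloisRep_five_and_surjective_three)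
    (h721 : BCDT.CDT_theorem_7_2_1) (h722 : BCDT.CDT_theorem_7_2_2)
    (h723 : BCDT.CDT_lemma_7_2_3_isModular)
    (hOgg3 : ∀ W : WeierstrassCurve ℚ,
      W.swanConductorAt_rationalTate_eq_wildConductorExponent_of_ringChar_eq_three 5) :
    exists_cuspForm_coeff_eq_frobeniusTrace :=
  exists_cuspForm_coeff_eq_frobeniusTrace_of_exists_isNewformOf
    (BCDT.exists_isNewformOf_of_wild_of_auxiliaryCurve_of_CDT721_722_723_of_ogg3 hW hE h721 h722
      h723 hOgg3)

/-- **lang.S33 from Theorem B and the printed inputs of CDT §7.2, on Ogg's formula at `p = 3`**: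
granted the named facts Theorem B (BCDT 2001), CDT Thms. 7.2.1, 7.2.2, Lemma 7.2.3 (modularity),
the `3`–`5` switch and Ogg's formula at the additive places of residue characteristic `3`
(`ℓ = 5`), every elliptic `E / ℚ` has a cusp form `f ∈ S₂(Γ₀(N))` with `a_p(f) = p + 1 - #E(𝔽_p)`
for `p ∤ N Δ_E` (`exists_cuspForm_coeff_eq_frobeniusTrace_of_exists_isNewformOf`, `LangWave0Proofs`,
applied to `exists_isNewformOf_of_theoremB_of_CDT721_722_723_switch_of_ogg3`).
[cite: BCDTJAMS2001, Theorem 2.2.2] -/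
theorem exists_cuspForm_coeff_eq_frobeniusTrace_of_theoremB_of_CDT721_722_723_switch_of_ogg3
    (hB : BCDT.theoremB) (h721 : BCDT.CDT_theorem_7_2_1) (h722 : BCDT.CDT_theorem_7_2_2)
    (h723 : BCDT.CDT_lemma_7_2_3_isModular) (hsw : BCDT.CDT_three_five_switch)
    (hOgg3 : ∀ W : WeierstrassCurve ℚ,
      W.swanConductorAt_rationalTate_eq_wildConductorExponent_of_ringChar_eq_three 5) :
    exists_cuspForm_coeff_eq_frobeniusTrace :=
  exists_cuspForm_coeff_eq_frobeniusTrace_of_exists_isNewformOf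
    (BCDT.exists_isNewformOf_of_theoremB_of_CDT721_722_723_switch_of_ogg3 hB h721 h722 h723 hsw hOgg3)

end Literature.NumberTheory.Automorphic

end
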